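import Summits.AtomisticToContinuum.HydrodynamicLimit.Theorems.LambertianContactSwapLambertianEulerCollisionalInputs
import Summits.AtomisticToContinuum.HydrodynamicLimit.Theorems.LambertianContactSwapLambertianEulerCompensatedJump
import HarnessLib

/-!
# The static pair bound of the compensated collision jump (crux `LambertianEuler`, stmt-AtomisticToContinuum-11854, line `Sketch`, stub `abs_Jcol_le_pair`)

Support file (`--supports stmt-AtomisticToContinuum-11854`).  Registered sub-goal `abs_Jcol_le_pair`
(S4 of lead c9, input of the reshape of CAT-Λ `…CollisionalInputs.CollisionActivityTailsLambda` to its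
Euler-free core): the compensated jump `Jcol σ Rf ρ θ u N t w` of the reference one-body exponent
`Σ_i g_t` (`…ClampedCurrentsDockPathwise.gSum`) at the Lambertian redraw of the incoming pair of the EXIT
configuration `w♭ = S_{τ(w)} w` is

* `0` if `w♭` has no incoming contact pair (the redraw `lambertStepMap` is then the identity and the
  Gaussian noise is a probability measure);
* bounded by `2 L ε_N (1 + ‖v_i‖² + ‖v_j‖²)` if `(i, j)` is the redrawn incoming pair, where `ε_N = hsDiameter σ N`
  is the contact distance and `L` is a common Lipschitz constant (in the minimal-image distance of `𝕋³`) of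
  the profiles `u_t/θ_t` (coordinatewise) and `1/θ_t`.

## Proof

By the landed closed form `…CompensatedJump.stub_compensatedJumpExponentLambda`,
`Jcol = -⟪δ, θ_i⁻¹ (c - u_i) - θ_j⁻¹ (c - u_j)⟫` with `c = (v_i + v_j)/2`, `gv = v_i - v_j`,
`δ = (‖gv‖/3) ω̂ - gv/2` (`ω̂` the unit contact vector), `θ_i = θ_t(x_i)`, `u_i = u_t(x_i)`.  Cauchy–Schwarz,
`‖δ‖ ≤ (5/6)‖gv‖`, and the rearrangement
`θ_i⁻¹ (c - u_i) - θ_j⁻¹ (c - u_j) = (θ_i⁻¹ - θ_j⁻¹) c - (θ_i⁻¹ u_i - θ_j⁻¹ u_j)` whose two terms are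
`≤ L ε ‖c‖` and `≤ 2 L ε` (coordinatewise Lipschitz bound and `√3 ≤ 2`) across the contact distance
`euclidDist x_i x_j = ‖sepVec x_i x_j‖ = ε`, give `|Jcol| ≤ (5/6) L ε ‖gv‖ (‖c‖ + 2)`; finally
`‖gv‖ ≤ A + B`, `‖c‖ ≤ (A + B)/2` (`A = ‖v_i‖`, `B = ‖v_j‖`) and
`(5/6)(A + B)((A + B)/2 + 2) ≤ 2 (1 + A² + B²)`.  Free flight does not change velocities, so the
velocities of `w♭` are those of `w`.

References: H.-T. Yau, *Relative entropy and hydrodynamics of Ginzburg–Landau models*, Lett. Math. Phys. 22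
(1991) §2 (gradient bounds of the local Gibbs exponent across an interaction range).  All statements here
[folklore].
-/

noncomputable section

namespace Summit.AtomisticToContinuum.HydrodynamicLimit.Theorems.LambertianContactSwapLambertianEulerJcolPairBound

open scoped BigOperators Topology ENNReal InnerProductSpace
open MeasureTheory ProbabilityTheory Filter Set InformationTheory
open Literature.MathematicalPhysics.KineticTheory
open Literature.Analysis.FluidPDE Literature.Analysis.FluidPDE.Alexander
open Summit.AtomisticToContinuum.HydrodynamicLimit.Theorems.LambertianContactSwapLambertianEulerCollisionalInputs
open Summit.AtomisticToContinuum.HydrodynamicLimit.Theorems.ClampedCurrentsDockPathwise (gSum gExp)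
open Summit.AtomisticToContinuum.HydrodynamicLimit.Theorems.LambertianContactSwapLambertianEulerCompensatedJump
  (stub_compensatedJumpExponentLambda)

/-! ## Elementary estimates -/

/-- `‖(‖gv‖/3) ŝ - gv/2‖ ≤ (5/6) ‖gv‖` for a unit vector `ŝ = s/‖s‖`, `s ≠ 0`. [folklore] -/
theorem norm_delta_le (gv s : V3) (hs : s ≠ 0) :
    ‖(‖gv‖ / 3) • (‖s‖⁻¹ • s) - (2 : ℝ)⁻¹ • gv‖ ≤ 5 / 6 * ‖gv‖ := by
  have h1 : ‖(‖gv‖ / 3) • (‖s‖⁻¹ • s)‖ = ‖gv‖ / 3 := by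
    rw [norm_smul, norm_smul, norm_inv, norm_norm, inv_mul_cancel₀ (norm_ne_zero_iff.2 hs), mul_one,
      Real.norm_of_nonneg (by positivity)]
  have h2 : ‖(2 : ℝ)⁻¹ • gv‖ = 2⁻¹ * ‖gv‖ := by
    rw [norm_smul, Real.norm_of_nonneg (by norm_num)]
  linarith [norm_sub_le ((‖gv‖ / 3) • (‖s‖⁻¹ • s)) ((2 : ℝ)⁻¹ • gv)]

/-- The rearrangement `a (c - uᵢ) - b (c - uⱼ) = (a - b) c - (a uᵢ - b uⱼ)`. [folklore] -/
theorem smul_sub_sub_smul_sub (a b : ℝ) (c ui uj : V3) :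
    a • (c - ui) - b • (c - uj) = (a - b) • c - (a • ui - b • uj) := by
  simp only [smul_sub, sub_smul]
  abel

/-- In `ℝ³`, a coordinatewise bound `|y_k| ≤ M` gives `‖y‖ ≤ 2M` (`√3 ≤ 2`). [folklore] -/
theorem norm_le_two_mul_of_forall_abs_le {y : V3} {M : ℝ} (hM : 0 ≤ M) (h : ∀ k, |y k| ≤ M) :
    ‖y‖ ≤ 2 * M := by
  rw [EuclideanSpace.norm_eq, Real.sqrt_le_left (by positivity)]
  calc ∑ k, ‖y k‖ ^ 2 ≤ ∑ _k : Fin 3, M ^ 2 := Finset.sum_le_sum fun k _ => by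
          rw [Real.norm_eq_abs]
          exact pow_le_pow_left₀ (abs_nonneg _) (h k) 2
    _ = 3 * M ^ 2 := by simp
    _ ≤ (2 * M) ^ 2 := by nlinarith [sq_nonneg M]

/-- The scalar inequality `(5/6)(A + B)((A + B)/2 + 2) ≤ 2 (1 + A² + B²)`
(from `(A + B)² ≤ 2 (A² + B²)` and `A + B ≤ 1 + (A² + B²)/2`). [folklore] -/
theorem pair_scalar_ineq (A B : ℝ) :
    5 / 6 * (A + B) * ((A + B) / 2 + 2) ≤ 2 * (1 + A ^ 2 + B ^ 2) := by
  nlinarith [sq_nonneg (A - B), sq_nonneg (A - 1), sq_nonneg (B - 1), sq_nonneg A, sq_nonneg B]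

/-! ## The registered stub -/

/-- **Registered sub-goal `abs_Jcol_le_pair`** (S4 of lead c9, line `Sketch`, crux stmt-AtomisticToContinuum-11854):
the compensated jump of the reference exponent at a Lambertian contact vanishes if the exit configuration has no
incoming contact pair, and otherwise is `O(ε_N)` times the kinetic content of the redrawn pair:
`|Jcol| ≤ 2 L ε_N (1 + ‖v_i‖² + ‖v_j‖²)`, `L` a common minimal-image Lipschitz constant of `u_t/θ_t`
(coordinatewise) and `θ_t⁻¹` on `[0, t₁]`, `θ > 0`.  Closed form `stub_compensatedJumpExponentLambda`,
Cauchy–Schwarz and the Lipschitz bounds across the contact distance `ε_N`. [folklore] -/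
theorem abs_Jcol_le_pair :
    ∀ {σ : ℝ}, 0 < σ → ∀ (Rf : ℝ → ℝ) (ρ θ : ℝ → T3 → ℝ) (u : ℝ → T3 → V3) (L t₁ : ℝ), 0 ≤ L →
      (∀ r ∈ Set.Icc 0 t₁, ∀ (x x' : T3) (j : Fin 3), |u r x j / θ r x - u r x' j / θ r x'| ≤ L * Torus.euclidDist x x') →
      (∀ r ∈ Set.Icc 0 t₁, ∀ x x' : T3, |(θ r x)⁻¹ - (θ r x')⁻¹| ≤ L * Torus.euclidDist x x') →
      (∀ r ∈ Set.Icc 0 t₁, ∀ x, 0 < θ r x) →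
      ∀ (N : ℕ), ∀ t ∈ Set.Icc 0 t₁, ∀ w : Config (N + 1) (Fin 3) T3,
        (¬ (incomingPairs (Torus.geometry (Fin 3)) (hsDiameter σ N)
              (freeFlight (Torus.geometry (Fin 3)) (freeExitTime (Torus.geometry (Fin 3)) (hsDiameter σ N) w).toReal w)).Nonempty →
            Jcol σ Rf ρ θ u N t w = 0) ∧
        ∀ hne : (incomingPairs (Torus.geometry (Fin 3)) (hsDiameter σ N)
            (freeFlight (Torus.geometry (Fin 3)) (freeExitTime (Torus.geometry (Fin 3)) (hsDiameter σ N) w).toReal w)).Nonempty,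
          |Jcol σ Rf ρ θ u N t w| ≤
            2 * L * hsDiameter σ N * (1 + ‖(w hne.some.1).2‖ ^ 2 + ‖(w hne.some.2).2‖ ^ 2) := by
  intro σ hσ Rf ρ θ u L t₁ hL hβ hγ hθ N t ht w
  unfold Jcol
  set a : ℝ → T3 → ℝ := fun r x => ρ r x * Rf (σ ^ 3 * ρ r x) with ha
  set G := Torus.geometry (Fin 3) with hG
  set ε := hsDiameter σ N with hε
  set w' := freeFlight G (freeExitTime G ε w).toReal w with hw'
  refine ⟨fun hne => ?_, fun hne => ?_⟩
  · -- no incoming pair: the redraw is the identity and the integrand is constant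
    have hstep : ∀ ξ : V3, lambertStepMap G (incomingPairs G ε w') w' ξ = w' := fun ξ => by
      rw [lambertStepMap, dif_neg hne]
    simp_rw [hstep]
    simp
  · -- the redrawn pair `(i, j)` is an incoming contact pair of `w'`
    obtain ⟨hlt, hcontact, -⟩ := mem_incomingPairs.1 hne.some_mem
    set i := hne.some.1 with hi
    set j := hne.some.2 with hj
    have hij : i ≠ j := ne_of_lt hlt
    have hε0 : 0 < ε := hsDiameter_pos hσ N
    have hdist : ‖G.sepVec (w' i).1 (w' j).1‖ = ε := (mem_contactSet.1 hcontact).2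
    have hdist' : Torus.euclidDist (w' i).1 (w' j).1 = ε := hdist
    have hsep : G.sepVec (w' i).1 (w' j).1 ≠ 0 := by
      intro h0
      rw [h0, norm_zero] at hdist
      exact hε0.ne hdist
    have hstep : ∀ ξ : V3, lambertStepMap G (incomingPairs G ε w') w' ξ = lambertPair G i j w' ξ :=
      fun ξ => by rw [lambertStepMap, dif_pos hne]
    simp_rw [hstep]
    -- the closed form of the noise-averaged jump (velocities of `w'` are those of `w`)
    have key : ∫ ξ, gSum a θ u t (lambertPair G i j w' ξ) ∂(stdGaussian V3) - gSum a θ u t w' =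
        -⟪(‖(w i).2 - (w j).2‖ / 3) • (‖G.sepVec (w' i).1 (w' j).1‖⁻¹ • G.sepVec (w' i).1 (w' j).1) -
            (2 : ℝ)⁻¹ • ((w i).2 - (w j).2),
          (θ t (w' i).1)⁻¹ • ((2 : ℝ)⁻¹ • ((w i).2 + (w j).2) - u t (w' i).1) -
            (θ t (w' j).1)⁻¹ • ((2 : ℝ)⁻¹ • ((w i).2 + (w j).2) - u t (w' j).1)⟫_ℝ :=
      stub_compensatedJumpExponentLambda (N + 1) G i j hij w' hsep (fun x => ρ t x * Rf (σ ^ 3 * ρ t x))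
        (θ t) (u t) (hθ t ht _) (hθ t ht _)
    rw [key, abs_neg, smul_sub_sub_smul_sub]
    -- abbreviations
    set xi := (w' i).1 with hxi
    set xj := (w' j).1 with hxj
    set vi := (w i).2 with hvi
    set vj := (w j).2 with hvj
    set s := G.sepVec xi xj with hs
    -- the Lipschitz bounds across the contact distance
    have h1 : |(θ t xi)⁻¹ - (θ t xj)⁻¹| ≤ L * ε := by
      have h := hγ t ht xi xj
      rwa [hdist'] at h
    have h2 : ‖(θ t xi)⁻¹ • u t xi - (θ t xj)⁻¹ • u t xj‖ ≤ 2 * (L * ε) := by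
      refine norm_le_two_mul_of_forall_abs_le (by positivity) fun k => ?_
      have h := hβ t ht xi xj k
      rw [hdist', div_eq_inv_mul, div_eq_inv_mul] at h
      simpa only [PiLp.sub_apply, PiLp.smul_apply, smul_eq_mul] using h
    have hδ : ‖(‖vi - vj‖ / 3) • (‖s‖⁻¹ • s) - (2 : ℝ)⁻¹ • (vi - vj)‖ ≤ 5 / 6 * (‖vi‖ + ‖vj‖) :=
      (norm_delta_le (vi - vj) s hsep).trans
        (mul_le_mul_of_nonneg_left (norm_sub_le _ _) (by norm_num))
    have hc : ‖(2 : ℝ)⁻¹ • (vi + vj)‖ ≤ (‖vi‖ + ‖vj‖) / 2 := by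
      rw [norm_smul, Real.norm_of_nonneg (by norm_num)]
      linarith [norm_add_le vi vj]
    have hR : ‖((θ t xi)⁻¹ - (θ t xj)⁻¹) • ((2 : ℝ)⁻¹ • (vi + vj)) -
          ((θ t xi)⁻¹ • u t xi - (θ t xj)⁻¹ • u t xj)‖ ≤
        L * ε * ((‖vi‖ + ‖vj‖) / 2) + 2 * (L * ε) := by
      refine (norm_sub_le _ _).trans (add_le_add ?_ h2)
      rw [norm_smul, Real.norm_eq_abs]
      exact mul_le_mul h1 hc (norm_nonneg _) (by positivity)
    have hLε : 0 ≤ L * ε := by positivity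
    calc |⟪(‖vi - vj‖ / 3) • (‖s‖⁻¹ • s) - (2 : ℝ)⁻¹ • (vi - vj),
            ((θ t xi)⁻¹ - (θ t xj)⁻¹) • ((2 : ℝ)⁻¹ • (vi + vj)) -
              ((θ t xi)⁻¹ • u t xi - (θ t xj)⁻¹ • u t xj)⟫_ℝ|
          ≤ ‖(‖vi - vj‖ / 3) • (‖s‖⁻¹ • s) - (2 : ℝ)⁻¹ • (vi - vj)‖ *
            ‖((θ t xi)⁻¹ - (θ t xj)⁻¹) • ((2 : ℝ)⁻¹ • (vi + vj)) -
              ((θ t xi)⁻¹ • u t xi - (θ t xj)⁻¹ • u t xj)‖ := abs_real_inner_le_norm _ _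
      _ ≤ (5 / 6 * (‖vi‖ + ‖vj‖)) * (L * ε * ((‖vi‖ + ‖vj‖) / 2) + 2 * (L * ε)) :=
          mul_le_mul hδ hR (norm_nonneg _) (by positivity)
      _ = L * ε * (5 / 6 * (‖vi‖ + ‖vj‖) * ((‖vi‖ + ‖vj‖) / 2 + 2)) := by ring
      _ ≤ L * ε * (2 * (1 + ‖vi‖ ^ 2 + ‖vj‖ ^ 2)) :=
          mul_le_mul_of_nonneg_left (pair_scalar_ineq _ _) hLε
      _ = 2 * L * ε * (1 + ‖vi‖ ^ 2 + ‖vj‖ ^ 2) := by ring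

end Summit.AtomisticToContinuum.HydrodynamicLimit.Theorems.LambertianContactSwapLambertianEulerJcolPairBound

end
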